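import Literature.MathematicalPhysics.QuantumFieldTheory.Balaban1983to89.Node00.Record10
import Literature.MathematicalPhysics.QuantumFieldTheory.Balaban1983to89.Node00.Record9ProvisosOfRegularity

/-!
# NODE 00 — K0′ COMPONENTS G3 (rows P1 `intPiece`, P2 `measω`, P3 `measChi` of `Provisos₁₂.base`): the three measurability ∕ integrability
# clauses of the represented tower of record REDUCED TO ONE DISPLAYED CLAUSE about def-R's (2.12) solution map — generic in the Stage-9
# parameter (any `A₁`, `ζ`, `τ`; identity selector), with NO bound on the marginal density of the averaging transport

Cell `pub-ymgap`, NODE 00, prover seat `pub-ymgap-node00-def-K0c` (g0; director LINE №92 (3), R176; dag-lead NODE-TABLE v24 § K0′ components, rows P1∕P2∕P3).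
[III] = [Balaban1988Convergent], [IV] = [Balaban1989LargeFieldI].

WHAT THIS FILE IS.  K0′ `Record12Inhabited` asks for ONE admissible `θ : Stage12Params F 2` with every field of `Provisos₁₂` a theorem; `Provisos₁₂.base` is
`θ.toStage9Params.Provisos₁₀` (`Record10`), whose fields `measChi` (the front factors `χ_{k+1}(s′)` of (2.18), `chiSeqOfRecord`, measurable), `measω` (n02-b's
(O4): the label weights `ω = a·b·ζ` of (3.2)·(3.3)·(3.16), `ωOfRecord`, jointly measurable in `(V′, U)`) and `intPiece` (the pieces `χ_k(s)·slot_k(s)` of `ρ_k`,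
`slotsOfRecord`, integrable, `k < K`) are this file's rows.  All three are stated on objects the tree defines through def-R's TOTALISED solution map of (2.12)
[III] (`UminOfRecord`, a `Classical.choose`, inside (2.16)'s `ukBox (bgOfRecord …)`); by dag-n23-b's census (`K0-TYPING-CENSUS.md` v1.2, kernel form
`Node00/Record9ProvisosOfRegularity`) they are, at `N ≥ 2`, NOT consequences of analysis of Bałaban's objects (a kernel proof must hold for EVERY selector) but
only of a choice-independence theorem or of a definition-side re-point of that map.  This file supplies neither; it proves the SHARPEST REDUCTION the rows admit:
* §1 ONE displayed clause **`LocalBgMeasurable F N ν`** (H-U): every LOCAL BACKGROUND OF RECORD `V ↦ U_{k,□}(V) = ukBox (bgOfRecord (avOfRecord F N K) reg_k) ν.M₁ □ k V`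
  ((2.16) over the (2.12) datum) is a measurable map — the census' (R-b) regularity, stated ONCE at the strength the three rows read; a HYPOTHESIS, never asserted
  (`localBgMeasurable_of_measurable_Umin`: it follows from measurability of def-R's primitive `UminOfRecord`); and the bookkeeping companion **`ZetaMeasurable ζ`**
  (H-ζ): the RESIDUAL fluctuation factor `ζ_{k+1}(R,S)(U,V′)` (K0b's choice) is jointly measurable (trivial for a field-constant residual).
* §2 (P3) under (H-U): `χ_k(T_η)`, `χ_k(Ω_k)` (EVERY level) and the (3.2) factors are measurable (products of indicators of preimages of measurable events).
* §3 (P2) under (H-U) ∧ (H-ζ): `a(P)`, `b(P,Q)` ((3.4)'s `V^{(k)}_{□′} = M^k(U_{k+1,□′}(V′))` measurable by (H-U) and `T4Continuum.measurable_iter`; the (3.3) event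
  `|V_k(b)(V^{(k)}_{□′}(b))⁻¹ − 1| < 2δ_k` by `RegularGaugeGroup (SU N)`), hence `ωOfRecord … A₁ ζ` for EVERY `A₁`, and the step weights `wOfRecord A₁ ζ`.
* §4 (P1) WITHOUT THE MARGINAL-DENSITY BOUND: n23-b's `slotsOfRecord_measurable_and_bounded` carries BOUNDED pieces and so needs (H-h) `∀ V′, avgDensity … V′ ≤ C`,
  a pointwise bound on Mathlib's Radon–Nikodym REPRESENTATIVE — unprovable for a reason foreign to print.  Integrability does not need it: the T-step (†) of an
  INTEGRABLE piece against a bounded jointly measurable weight is integrable by def-T's `integrable_transport_piece` (disintegration, `HaarAC`, `k < K`) —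
  `integrable_tstepOfRecord`; the R-step at the identity selector multiplies a slot by `F∕F ∈ {0,1}` (`abs_rstepSlot_ppSelId_le`, no sign condition); so every
  post-𝐑 slot is measurable AND integrable (`slotsOfRecord_measurable_integrable_ppSelId`) and `intPiece` holds at every `k < K` given measurable χ's up to
  level `k` and jointly measurable weights with `|w| ≤ 1` (the ζ-size law) — no (H-h), no `0 ≤ ζ`.
* §5 THE THREE ROWS at a Stage-9 parameter with the identity selector (`θ.ppSel = ppSelIdOfRecord …`, the selector of every carrier of record so far) along the
  Stage-10 histories `gOfRecord₁₀ θ`, VERBATIM as `Provisos₁₀` displays them.  STAGE-12 READING: `Provisos₁₂.base` IS `θ.toStage9Params.Provisos₁₀` (def-T's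
  `Record12`), so the three fields of `base` at a `θ : Stage12Params` are §5 applied to `θ.toStage9Params` — no `Record12` import is needed (v1: none, so the
  file lands while the `Record12` olean is rebuilt; a §6 one-line corollary keyed to `Stage12Params` may be appended later).
NET: P1 ∧ P2 ∧ P3 ⇐ (H-U) ∧ (H-ζ) ∧ `IsZetaAbsLeOne θ.ζ` (K0b's row P5).  At `N = 1` (H-U) is trivial; at `N ≥ 2` it is the census' open (R-b) item.

HONEST FRAMING — what this is NOT.  A REDUCTION and kernel plumbing (Mathlib, def-T's disintegration lemmas, n23-b's propagation lemmas, BY NAME); (H-U), (H-ζ) are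
DISPLAYED HYPOTHESES, neither asserted nor discharged; nothing of Bałaban's is asserted ([III] §3, [IV] §1, [B11] Thm 1 not used); no field of `Provisos₁₂` is
inhabited here at `N ≥ 2`; K0′ is NOT discharged; no node count moves (typed 28∕28 · discharged 5∕28).  One finite four-torus programme at fixed `ε = L^{−K}` — NOT the
continuum limit on ℝ⁴, NOT infinite volume, NOT OS, NOT a mass gap, NOT the Clay problem.
-/

noncomputable section

open MeasureTheory
open scoped BigOperators NNReal ENNReal

namespace Literature.MathematicalPhysics.QuantumFieldTheory.Balaban1983to89.Node00

open T4Continuum B14.Eq218Concrete T4AveragingDisintegration T4FiniteEpsInhabited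
open B15DeterminingSets B14.Eq213DetSet B14.Eq216Concrete B14.Sect3Decomp
open Literature.MathematicalPhysics.QuantumFieldTheory.BalabanImbrieJaffe1984to88.BIJ85Eq453GaugeField (qsstarG qsstarGIter0 qsstarG_apply
  qsstarGIter0_succ)

/-! ## §0. Folklore measurability (the tree's `T4AxialGaugeFixing.measurable_chiSmall`, `BIJ88RT51Background42.measurable_qsstarGIter0`,
restated privately so as not to import those chains) -/

section Folklore

variable {P : Params} {j : ℕ} {G : Type*} [MeasurableSpace G]

/-- The small-field event `{U | |U(∂p) − 1| < δ, p ∈ S}` is a measurable set of configurations. [folklore] -/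
private theorem measurableSet_plaqSmallOn' [GaugeGroup G] [RegularGaugeGroup G] (S : Set (Plaq P j)) (δ : ℝ) :
    MeasurableSet {U : GaugeField P j G | PlaqSmallOn S δ U} := by
  have h : {U : GaugeField P j G | PlaqSmallOn S δ U} = ⋂ p : {p : Plaq P j // p ∈ S}, {U | dist1 (GaugeField.plaqHol U p.1) < δ} := by
    ext U; simp only [PlaqSmallOn, Set.mem_setOf_eq, Set.mem_iInter, Subtype.forall]
  rw [h]
  exact MeasurableSet.iInter fun p =>
    measurableSet_lt (RegularGaugeGroup.measurable_dist1.comp (Missing.measurable_plaqHol p.1)) measurable_const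

/-- The small-field factor `χ({…}) = chiSmall S δ` is measurable. [folklore] -/
private theorem measurable_chiSmall' [GaugeGroup G] [RegularGaugeGroup G] (S : Set (Plaq P j)) (δ : ℝ) :
    Measurable (chiSmall S δ : GaugeField P j G → ℝ) := by
  unfold chiSmall
  exact Measurable.ite (measurableSet_plaqSmallOn' S δ) measurable_const measurable_const

/-- The one-step pull-back (1.3) `Q^{s*}` is measurable (each bond variable is `1` or a bond variable of `V`). [folklore] -/
private theorem measurable_qsstarG' [One G] : Measurable (qsstarG : GaugeField P (j + 1) G → GaugeField P j G) := by
  refine measurable_pi_iff.mpr fun b => ?_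
  by_cases h : blockOf b.tgt = blockOf b.src
  · simp only [qsstarG_apply, if_pos h]; exact measurable_const
  · simp only [qsstarG_apply, if_neg h]; exact measurable_pi_apply _

/-- `Q^{s*}_k` is measurable. [folklore] -/
private theorem measurable_qsstarGIter0' [One G] : ∀ k : ℕ, Measurable (qsstarGIter0 k : GaugeField P k G → GaugeField P 0 G)
  | 0 => measurable_id
  | k + 1 => by
    rw [show (qsstarGIter0 (k + 1) : GaugeField P (k + 1) G → GaugeField P 0 G) = fun V => qsstarGIter0 k (qsstarG V) from
      funext fun V => qsstarGIter0_succ k V]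
    exact (measurable_qsstarGIter0' k).comp measurable_qsstarG'

end Folklore

variable (F : T4Family) (N : ℕ) [NeZero N]

/-! ## §1. The displayed clauses (H-U) and (H-ζ) -/

/-- **(H-U) — THE LOCAL BACKGROUNDS OF RECORD ARE MEASURABLE** (DISPLAYED HYPOTHESIS, never asserted): for every torus `K`, level `k` and enlarged cube `□ ⊂ T_η`,
the (2.16) local background `V_k ↦ U_{k,□}(V_k) = U(𝐁_k(□), M˙(Q_k^{s*}V_k))` over def-R's TOTALISED (2.12) solution datum `bgOfRecord` (regularity class
`|U(∂p) − 1| < εreg·η_k²`, layer width `M₁`) is a measurable map of the field.  The regularity of the (2.12) solution map that dag-n23-b's census ((R-b))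
isolates: at `N ≥ 2` provable only from a choice-independence theorem for the minimal orbits or after a definition-side re-point of `UminOfRecord`; at `N = 1`
trivial.  Print: `U_{k,□}(V)` is an explicit analytic function of regular `V`. [cite: Balaban1988Convergent, (2.12) p.256, (2.16) p.257] -/
def LocalBgMeasurable (ν : Stage7Numerics) : Prop :=
  ∀ (K k : ℕ) (box4 : Set (Site (F.P K) 0)),
    Measurable (ukBox (bgOfRecord (avOfRecord F N K) {U | PlaqSmall (ν.εreg * (F.P K).eta k ^ 2) U}) ν.M₁ box4 k)

/-- **(H-ζ) — THE RESIDUAL FLUCTUATION FACTOR IS JOINTLY MEASURABLE** (DISPLAYED, bookkeeping): every `ζ_{k+1}(R,S)` of (3.16)·(3.20)·(3.21), as a function of the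
old and new fields `(U, V′)`, is measurable on the product (trivial for a residual constant in the fields; displayed because the residual is a parameter of the
record). [cite: Balaban1988Convergent, (3.16) p.268, (3.20)–(3.21) p.269 (bookkeeping)] -/
def ZetaMeasurable {ν : Stage7Numerics} {M : ℕ} (ζ : ZetaOfRecord F N ν M) : Prop :=
  ∀ (p : B12.RunParams) (g : ℕ → ℝ) (k : ℕ) (s : SeqOfRecord F ν M g p.K k) (Pl Ql : Finset (Iχ F ν p g k))
    (RS : Finset (Iχ F ν p g k) × Finset (Iχ F ν p g k)),
    Measurable (fun z : GaugeField (F.P p.K) (k + 1) (SU N) × GaugeField (F.P p.K) k (SU N) => ζ p g k s Pl Ql RS z.2 z.1)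

section Clauses

variable {F N}

/-- A residual that does not read the fields satisfies (H-ζ). [cite: Balaban1988Convergent, (3.16) p.268 (bookkeeping)] -/
theorem zetaMeasurable_of_const {ν : Stage7Numerics} {M : ℕ} (ζ : ZetaOfRecord F N ν M)
    (h : ∀ p g k s Pl Ql RS U U' V V', ζ p g k s Pl Ql RS U V = ζ p g k s Pl Ql RS U' V') : ZetaMeasurable F N ζ := by
  intro p g k s Pl Ql RS
  have e : (fun z : GaugeField (F.P p.K) (k + 1) (SU N) × GaugeField (F.P p.K) k (SU N) => ζ p g k s Pl Ql RS z.2 z.1)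
      = fun _ => ζ p g k s Pl Ql RS 1 1 := funext fun z => h p g k s Pl Ql RS z.2 1 z.1 1
  exact e ▸ measurable_const

/-- **(H-U) FROM MEASURABILITY OF def-R's PRIMITIVE**: if the (2.12) solution map of record `UminOfRecord (avOfRecord F N K) reg_k 𝔹` is measurable on multi-scale
data for every determining set `𝔹` and every level's regularity class, then every local background of record is measurable (the data map `V_k ↦ M˙(Q_k^{s*}V_k)`
is: iterated averaging of record and the (1.3) pull-back are). [cite: Balaban1988Convergent, (2.11)–(2.12) p.256, (2.16) p.257 (bookkeeping)] -/
theorem localBgMeasurable_of_measurable_Umin (ν : Stage7Numerics)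
    (hU : ∀ (K k : ℕ) (𝔹 : DetSet (F.P K)),
      Measurable (UminOfRecord (avOfRecord F N K) {U : GaugeField (F.P K) 0 (SU N) | PlaqSmall (ν.εreg * (F.P K).eta k ^ 2) U} 𝔹)) :
    LocalBgMeasurable F N ν := by
  intro K k box4
  have hM : Measurable (avgFamily (avOfRecord F N K) : GaugeField (F.P K) 0 (SU N) → MSField (F.P K) (SU N)) :=
    measurable_pi_lambda _ fun j => measurable_iter (avOfRecord F N K) (avOfRecord_measurable F N K) j
  exact (hU K k (Bj ν.M₁ box4 k)).comp (hM.comp (measurable_qsstarGIter0' k))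

end Clauses

/-! ## §2. (P3) the front factors: `χ_k(T_η)`, `χ_k(Ω_k)`, the (3.2) factors are measurable under (H-U) -/

section Chi

variable {F N} {ν : Stage7Numerics} (hU : LocalBgMeasurable F N ν)
include hU

/-- `χ_k(T_η)` of record is measurable under (H-U). [cite: Balaban1988Convergent, (2.17) p.257 (bookkeeping)] -/
theorem measurable_chiOfRecord_of_localBg (g : ℕ → ℝ) (K k : ℕ) : Measurable (chiOfRecord F N ν g K k) := by
  rw [chiOfRecord_eq_chi217]
  unfold chi217
  exact Finset.measurable_prod _ fun c _ => (measurable_chiSmall' _ _).comp (hU K k _)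

/-- **(P3)** `χ_k(Ω_k)` of record is measurable at EVERY level and sequence under (H-U). [cite: Balaban1988Convergent, (2.17)–(2.18) p.257 (bookkeeping)] -/
theorem measurable_chiSeqOfRecord_of_localBg (M : ℕ) (g : ℕ → ℝ) (K k : ℕ) (s : SeqOfRecord F ν M g K k) :
    Measurable (chiSeqOfRecord F N ν M g K k s) := by
  unfold chiSeqOfRecord chi218 chi217
  exact Finset.measurable_prod _ fun c _ => (measurable_chiSmall' _ _).comp (hU K k _)

/-- The (3.2) factor of record `χ({sup_{p⊂□′^∼}|U_{k+1,□′}(∂p) − 1| < ε_{k+1}(L⁻¹η)²})` is measurable in `V′` under (H-U). [cite: Balaban1988Convergent, (3.2) p.265 (bookkeeping)] -/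
theorem measurable_chiFactor_of_localBg (p : B12.RunParams) (g : ℕ → ℝ) (k : ℕ) (c : Iχ F ν p g k) :
    Measurable (chiFactor F N ν p g k c) := by
  unfold chiFactor
  exact (measurable_chiSmall' _ _).comp (hU p.K (k + 1) _)

end Chi

/-! ## §3. (P2) the label weights `ω = a·b·ζ` and the step weights are jointly measurable under (H-U) ∧ (H-ζ) -/

section Omega

variable {F N} {ν : Stage7Numerics} (hU : LocalBgMeasurable F N ν)
include hU

/-- The (3.2) label weight `a(P)(V′)` of record is measurable under (H-U). [cite: Balaban1988Convergent, (3.2) p.265 (bookkeeping)] -/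
theorem measurable_aWeight_of_localBg (M : ℕ) (p : B12.RunParams) (g : ℕ → ℝ) (k : ℕ) (s : SeqOfRecord F ν M g p.K k)
    (Pl : Finset (Iχ F ν p g k)) : Measurable (aWeight F N ν M p g k s Pl) := by
  have hf : ∀ c : Iχ F ν p g k, Measurable fun V' : GaugeField (F.P p.K) (k + 1) (SU N) =>
      chiSmall ((sect3DataOfRecord F N ν M p g k s).plaqT c) (epsOfRecord ν g (k + 1) * (F.P p.K).eta (k + 1) ^ 2)
        ((sect3DataOfRecord F N ν M p g k s).UkLoc c V') :=
    fun c => measurable_chiFactor_of_localBg hU p g k c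
  unfold aWeight
  by_cases hP : Pl ⊆ cubes32 F ν M p g k s
  · simp only [if_pos hP]
    unfold chiNext chiNextc
    exact (Finset.measurable_prod _ fun c _ => hf c).mul (Finset.measurable_prod _ fun c _ => measurable_const.sub (hf c))
  · simp only [if_neg hP]; exact measurable_const

/-- (3.4): `V′ ↦ V^{(k)}_{□′}(V′) = M^k(U_{k+1,□′}(V′))` is measurable under (H-U). [cite: Balaban1988Convergent, (3.4) p.265 (bookkeeping)] -/
theorem measurable_Vbox_of_localBg (M : ℕ) (p : B12.RunParams) (g : ℕ → ℝ) (k : ℕ) (s : SeqOfRecord F ν M g p.K k) (c : Iχ F ν p g k) :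
    Measurable (Vbox (sect3DataOfRecord F N ν M p g k s) (avOfRecord F N p.K) c) :=
  (measurable_iter (avOfRecord F N p.K) (avOfRecord_measurable F N p.K) k).comp (hU p.K (k + 1) _)

/-- The (3.3) event `{(V′,U) | sup_b |U(b)(V^{(k)}_{□′}(V′)(b))⁻¹ − 1| < 2δ_k}` is measurable under (H-U). [cite: Balaban1988Convergent, (3.3) p.265 (bookkeeping)] -/
theorem measurableSet_smallApproxFluct_of_localBg (M : ℕ) (p : B12.RunParams) (g : ℕ → ℝ) (k : ℕ) (s : SeqOfRecord F ν M g p.K k) (twoδ : ℝ)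
    (c : Iχ F ν p g k) :
    MeasurableSet {z : GaugeField (F.P p.K) (k + 1) (SU N) × GaugeField (F.P p.K) k (SU N) |
      SmallApproxFluct (sect3DataOfRecord F N ν M p g k s) (avOfRecord F N p.K) twoδ z.2 z.1 c} := by
  have hV := measurable_Vbox_of_localBg hU M p g k s c
  have e : {z : GaugeField (F.P p.K) (k + 1) (SU N) × GaugeField (F.P p.K) k (SU N) |
      SmallApproxFluct (sect3DataOfRecord F N ν M p g k s) (avOfRecord F N p.K) twoδ z.2 z.1 c}
      = ⋂ b ∈ (sect3DataOfRecord F N ν M p g k s).bondsStar c,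
          {z | dist1 (z.2 b * (Vbox (sect3DataOfRecord F N ν M p g k s) (avOfRecord F N p.K) c z.1 b)⁻¹) < twoδ} := by
    ext z; simp only [SmallApproxFluct, Set.mem_setOf_eq, Set.mem_iInter]
  rw [e]
  refine Finset.measurableSet_biInter _ fun b _ => measurableSet_lt (RegularGaugeGroup.measurable_dist1.comp ?_) measurable_const
  exact ((Missing.measurable_eval b).comp measurable_snd).mul ((Missing.measurable_eval b).comp (hV.comp measurable_fst)).inv

/-- The (3.3) label weight `b(P,Q)(U,V′)` of record is jointly measurable under (H-U), for every `A₁`. [cite: Balaban1988Convergent, (3.3)–(3.4) p.265 (bookkeeping)] -/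
theorem measurable_bWeight_of_localBg (M : ℕ) (p : B12.RunParams) (g : ℕ → ℝ) (k : ℕ) (A₁ : ℝ) (s : SeqOfRecord F ν M g p.K k)
    (Pl Ql : Finset (Iχ F ν p g k)) :
    Measurable (fun z : GaugeField (F.P p.K) (k + 1) (SU N) × GaugeField (F.P p.K) k (SU N) => bWeight F N ν M p g k A₁ s Pl Ql z.2 z.1) := by
  have hf : ∀ c : Iχ F ν p g k, MeasurableSet {z : GaugeField (F.P p.K) (k + 1) (SU N) × GaugeField (F.P p.K) k (SU N) |
      SmallApproxFluct (sect3DataOfRecord F N ν M p g k s) (avOfRecord F N p.K) (2 * deltaOfRecord ν g k A₁) z.2 z.1 c} :=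
    fun c => measurableSet_smallApproxFluct_of_localBg hU M p g k s _ c
  unfold bWeight
  by_cases hQ : Ql ⊆ qcubes F ν M p g k s Pl
  · simp only [if_pos hQ]
    unfold chiPrime chiPrimec
    exact (Finset.measurable_prod _ fun c _ => Measurable.ite (hf c) measurable_const measurable_const).mul
      (Finset.measurable_prod _ fun c _ => Measurable.ite (hf c) measurable_const measurable_const)
  · simp only [if_neg hQ]; exact measurable_const

/-- **(P2) — (O4) OF RECORD UNDER (H-U) ∧ (H-ζ)**: the label weights `ω s t (U, V′) = a(P)(V′)·b(P,Q)(U,V′)·ζ(R,S)(U,V′)` are jointly measurable, for every `A₁` and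
every residual `ζ` satisfying (H-ζ). [cite: Balaban1988Convergent, (3.2)–(3.5) p.265, (3.16) p.268, (3.24)–(3.25) p.270 (bookkeeping)] -/
theorem measurable_ωOfRecord_of_localBg (M : ℕ) (p : B12.RunParams) (g : ℕ → ℝ) (k : ℕ) (A₁ : ℝ) {ζ : ZetaOfRecord F N ν M}
    (hζ : ZetaMeasurable F N ζ) (s : SeqOfRecord F ν M g p.K k) (t : LbOfRecord F ν p g k) :
    Measurable (fun z : GaugeField (F.P p.K) (k + 1) (SU N) × GaugeField (F.P p.K) k (SU N) => ωOfRecord F N ν M p g k A₁ ζ s t z.2 z.1) := by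
  unfold ωOfRecord
  exact (((measurable_aWeight_of_localBg hU M p g k s t.1).comp measurable_fst).mul
    (measurable_bWeight_of_localBg hU M p g k A₁ s t.1 t.2.1)).mul (hζ p g k s t.1 t.2.1 t.2.2)

/-- … hence the step weights of record `wOfRecord A₁ ζ` are jointly measurable (n02-b's `measurable_wOfRecord`). [cite: Balaban1988Convergent, (3.2)–(3.3) p.265 (bookkeeping)] -/
theorem measurable_wOfRecord_of_localBg (M : ℕ) (A₁ : ℝ) {ζ : ZetaOfRecord F N ν M} (hζ : ZetaMeasurable F N ζ) (p : B12.RunParams) (g : ℕ → ℝ) (k : ℕ)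
    (s' : SeqOfRecord F ν M g p.K (k + 1)) :
    Measurable (fun z : GaugeField (F.P p.K) (k + 1) (SU N) × GaugeField (F.P p.K) k (SU N) => wOfRecord F N ν M A₁ ζ p g k s' z.2 z.1) :=
  measurable_wOfRecord F N ν M A₁ ζ p g k (fun s t => measurable_ωOfRecord_of_localBg hU M p g k A₁ hζ s t) s'

end Omega

/-! ## §4. (P1) integrability of the pieces WITHOUT a bound on the marginal density: T-step by disintegration, R-step at the identity selector -/

section IntPiece

variable (ν : Stage7Numerics) (M : ℕ) {p : B12.RunParams} {g : ℕ → ℝ} {k : ℕ}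

/-- **THE T-STEP (†) OF AN INTEGRABLE PIECE IS INTEGRABLE** (`k < K`): `(𝐓e^A)_{k+1}(s′) = h(V′)·∫ w(s′)(U,V′) χ_k(init s′)(U) slot(init s′)(U) κ_{V′}(dU)` is
integrable over `dV′` as soon as the old piece `χ_k(init s′)·slot(init s′)` is integrable and the weight is jointly measurable with `|w| ≤ 1` (def-T's
`integrable_transport_piece`: disintegration of the joint law of `(Ū, U)`, `HaarAC` of the averaging of record).  NO bound on `h = avgDensity` is used.
[cite: Balaban1988Convergent, (3.1) p.264, (3.24)–(3.25) p.270 (bookkeeping)] -/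
theorem integrable_tstepOfRecord (hk : k < p.K) {w : StepWeightsOfRecord F N ν M}
    (hw : ∀ s', Measurable (fun z : GaugeField (F.P p.K) (k + 1) (SU N) × GaugeField (F.P p.K) k (SU N) => w p g k s' z.2 z.1))
    (hwb : ∀ s' U V', |w p g k s' U V'| ≤ 1) {T : SeqOfRecord F ν M g p.K k → Density (F.P p.K) k (SU N)}
    (hT : ∀ s, Integrable (fun U => chiSeqOfRecord F N ν M g p.K k s U * T s U) (fieldMeasure (F.P p.K) k (SU N)))
    (s' : SeqOfRecord F ν M g p.K (k + 1)) :
    Integrable (tstepOfRecord F N ν M w p g k T s') (fieldMeasure (F.P p.K) (k + 1) (SU N)) := by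
  have e : tstepOfRecord F N ν M w p g k T s' = fun V' => (avgDensity (avOfRecord F N p.K k).avg V' : ℝ) *
      ∫ U, (chiSeqOfRecord F N ν M g p.K k s'.init U * T s'.init U) *
        (fun z : GaugeField (F.P p.K) (k + 1) (SU N) × GaugeField (F.P p.K) k (SU N) => w p g k s' z.2 z.1) (V', U)
          ∂(avgKernel (avOfRecord F N p.K k).avg V') := by
    funext V'; rw [show tstepOfRecord F N ν M w p g k T s' V' = _ from texpASucc_apply _ _ _ _ s' V']
    exact congrArg _ (integral_congr_ae (ae_of_all _ fun U => mul_comm _ _))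
  rw [e]
  exact integrable_transport_piece (avOfRecord_measurable F N p.K k) (avOfRecord_haarAC F N p.K k hk) (hT s'.init) (hw s')
    (C := 1) (fun z => by rw [Real.norm_eq_abs]; exact hwb s' z.2 z.1)

/-- A finite sum over all indices of a term supported at one index is that term (any decidability, any `Fintype` structure). [folklore] -/
private theorem sum_univ_ite_eq' {ι β : Type*} [AddCommMonoid β] {instF : Fintype ι} (s : ι) (T : ι → β)
    (d : ∀ a, Decidable (a = s)) : (∑ a ∈ @Finset.univ ι instF, @ite β (a = s) (d a) (T a) 0) = T s := by
  rw [Finset.sum_eq_single_of_mem s (Finset.mem_univ _) (fun b _ hb => by rw [if_neg hb]), if_pos rfl]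

variable (τ : TowerNumerics)

/-- **THE R-STEP AT THE IDENTITY SELECTOR DOES NOT INCREASE `|slot|`** (no sign condition): at `Z″ := Z` the R-stepped slot is the slot times one ratio `F∕F ∈ {0, 1}`.
[cite: Balaban1989LargeFieldI, (0.3) p.176 (bookkeeping)] -/
theorem abs_rstepSlot_ppSelId_le (f : TexpASlot F N ν τ.M p g k) (s : SeqOfRecord F ν τ.M g p.K k) (V : GaugeField (F.P p.K) k (SU N)) :
    |rstepSlot F N ν τ p g k (ppSelIdOfRecord F ν τ.M p g k) f s V| ≤ |f s V| := by
  unfold rstepSlot rstepOfSel ppSelIdOfRecord; dsimp only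
  simp only [Finset.sum_filter, sum_univ_ite_eq']
  unfold rratio; rw [abs_mul]
  exact mul_le_of_le_one_right (abs_nonneg _) (by rw [abs_div]; exact div_self_le_one _)

/-- **EVERY POST-𝐑 SLOT OF THE REPRESENTED TOWER OF RECORD IS MEASURABLE AND INTEGRABLE**, levels `k ≤ K`, at the identity selector — GIVEN measurable χ's of
record (levels `≤ K`) and jointly measurable step weights with `|w| ≤ 1`, nothing else (induction on the level: `ρ₀ = e^{−E}·e^{−A∕g₀²}` bounded measurable; T-step
`integrable_tstepOfRecord` ∕ `measurable_tstepOfRecord`; R-step `abs_rstepSlot_ppSelId_le` ∕ `measurable_rstepSlot_ppSelId`).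
[cite: Balaban1988Convergent, (2.18) p.257, (3.24)–(3.25) p.270; Balaban1989LargeFieldI, (0.3) p.176 (bookkeeping)] -/
theorem slotsOfRecord_measurable_integrable_ppSelId (E : B12.RunParams → ℝ) {w : StepWeightsOfRecord F N ν τ.M}
    (hw : ∀ k, k < p.K → ∀ s', Measurable (fun z : GaugeField (F.P p.K) (k + 1) (SU N) × GaugeField (F.P p.K) k (SU N) => w p g k s' z.2 z.1))
    (hwb : ∀ k, k < p.K → ∀ s' U V', |w p g k s' U V'| ≤ 1) (hχ : ∀ k, k ≤ p.K → ∀ s, Measurable (chiSeqOfRecord F N ν τ.M g p.K k s)) :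
    ∀ k, k ≤ p.K → (∀ s, Measurable (slotsOfRecord F N ν τ E w (ppSelIdOfRecord F ν τ.M) p g k s)) ∧
      ∀ s, Integrable (slotsOfRecord F N ν τ E w (ppSelIdOfRecord F ν τ.M) p g k s) (fieldMeasure (F.P p.K) k (SU N)) := by
  intro k; induction k with
  | zero =>
    intro _
    have hm : ∀ s : SeqOfRecord F ν τ.M g p.K 0, Measurable (slotsOfRecord F N ν τ E w (ppSelIdOfRecord F ν τ.M) p g 0 s) := fun s => by
      show Measurable (rhoZeroOfRecord F N p.K (g 0) (E p))
      exact (Missing.measurable_boltzmann RegularGaugeGroup.measurable_reTr (F.P p.K) _).const_mul _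
    refine ⟨hm, fun s => (integrable_const (Real.exp (-E p))).mono' (hm s).aestronglyMeasurable (ae_of_all _ fun V => ?_)⟩
    show ‖Real.exp (-E p) * Missing.boltzmann (F.P p.K) ((g 0)⁻¹ ^ 2) V‖ ≤ Real.exp (-E p)
    rw [Real.norm_eq_abs, abs_of_nonneg (mul_nonneg (Real.exp_pos _).le (Missing.boltzmann_pos (F.P p.K) _ V).le)]
    exact mul_le_of_le_one_right (Real.exp_pos _).le (Missing.boltzmann_le_one (F.P p.K) (sq_nonneg _) V)
  | succ k ih =>
    intro hk
    have hk' : k < p.K := Nat.lt_of_succ_le hk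
    obtain ⟨hm, hi⟩ := ih hk'.le
    have hpiece : ∀ s, Integrable (fun U => chiSeqOfRecord F N ν τ.M g p.K k s U * slotsOfRecord F N ν τ E w (ppSelIdOfRecord F ν τ.M) p g k s U)
        (fieldMeasure (F.P p.K) k (SU N)) := fun s =>
      (hi s).bdd_mul (hχ k hk'.le s).aestronglyMeasurable
        (ae_of_all _ fun U => by rw [Real.norm_eq_abs]; exact abs_chiSeqOfRecord_le_one F N ν τ.M g p.K k s U)
    have hTm : ∀ s', Measurable (slotsTOfRecord F N ν τ E w (ppSelIdOfRecord F ν τ.M) p g (k + 1) s') := fun s' => by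
      rw [slotsTOfRecord_succ]; exact measurable_tstepOfRecord F N ν τ.M (hw k hk') hm (hχ k hk'.le) s'
    have hTi : ∀ s', Integrable (slotsTOfRecord F N ν τ E w (ppSelIdOfRecord F ν τ.M) p g (k + 1) s') (fieldMeasure (F.P p.K) (k + 1) (SU N)) :=
      fun s' => by rw [slotsTOfRecord_succ]; exact integrable_tstepOfRecord F N ν τ.M hk' (hw k hk') (hwb k hk') hpiece s'
    refine ⟨fun s => ?_, fun s => ?_⟩
    · rw [slotsOfRecord_succ]; exact measurable_rstepSlot_ppSelId F N ν τ hTm (hχ (k + 1) hk) s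
    · rw [slotsOfRecord_succ]
      refine (hTi s).mono (measurable_rstepSlot_ppSelId F N ν τ hTm (hχ (k + 1) hk) s).aestronglyMeasurable (ae_of_all _ fun V => ?_)
      rw [Real.norm_eq_abs, Real.norm_eq_abs]
      exact abs_rstepSlot_ppSelId_le F N ν τ _ s V

/-- **(P1) AT THE GENERIC LEVEL — `intPiece` WITHOUT (H-h)**: at the identity selector, for every `k < K` and sequence `s`, the piece `χ_k(s)·slot_k(s)` of `ρ_k` of
the represented tower of record is integrable, GIVEN measurable χ's of record up to level `k` and jointly measurable step weights with `|w| ≤ 1` below level `k`.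
[cite: Balaban1988Convergent, (2.18) p.257, (3.24)–(3.25) p.270; Balaban1989LargeFieldI, (0.3)–(0.4) p.176 (bookkeeping)] -/
theorem intPiece_ppSelId_of_measurable (E : B12.RunParams → ℝ) {w : StepWeightsOfRecord F N ν τ.M}
    (hw : ∀ k, k < p.K → ∀ s', Measurable (fun z : GaugeField (F.P p.K) (k + 1) (SU N) × GaugeField (F.P p.K) k (SU N) => w p g k s' z.2 z.1))
    (hwb : ∀ k, k < p.K → ∀ s' U V', |w p g k s' U V'| ≤ 1) (hχ : ∀ k, k ≤ p.K → ∀ s, Measurable (chiSeqOfRecord F N ν τ.M g p.K k s))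
    (k : ℕ) (hk : k < p.K) (s : SeqOfRecord F ν τ.M g p.K k) :
    Integrable (fun U => chiSeqOfRecord F N ν τ.M g p.K k s U * slotsOfRecord F N ν τ E w (ppSelIdOfRecord F ν τ.M) p g k s U)
      (fieldMeasure (F.P p.K) k (SU N)) := by
  obtain ⟨-, hi⟩ := slotsOfRecord_measurable_integrable_ppSelId F N ν τ E hw hwb hχ k hk.le
  exact (hi s).bdd_mul (hχ k hk.le s).aestronglyMeasurable
    (ae_of_all _ fun U => by rw [Real.norm_eq_abs]; exact abs_chiSeqOfRecord_le_one F N ν τ.M g p.K k s U)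

end IntPiece

/-! ## §5. THE THREE ROWS at a Stage-9 parameter with the identity selector, along the Stage-10 histories — VERBATIM as `Provisos₁₀` displays them -/

section Stage9

variable {F N}

/-- **ROW P3 `measChi` UNDER (H-U)**: for every `θ : Stage9Params`, run `p`, step `k < K` and new sequence `s′`, the front factor `χ_{k+1}(s′)` along the generated
history `gOfRecord₁₀ θ p` is measurable — `Provisos₁₀.measChi` verbatim. [cite: Balaban1988Convergent, (2.17)–(2.18) p.257, (3.2) p.265 (bookkeeping)] -/
theorem Stage9Params.measChi_of_localBg (θ : Stage9Params F N) (hU : LocalBgMeasurable F N θ.ν) :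
    ∀ (p : B12.RunParams) (k : ℕ), k < p.K → ∀ s' : SeqOfRecord F θ.ν θ.τ9.M (gOfRecord₁₀ F N θ p) p.K (k + 1),
      Measurable (chiSeqOfRecord F N θ.ν θ.τ9.M (gOfRecord₁₀ F N θ p) p.K (k + 1) s') :=
  fun p k _ s' => measurable_chiSeqOfRecord_of_localBg hU θ.τ9.M _ p.K (k + 1) s'

/-- **ROW P2 `measω` UNDER (H-U) ∧ (H-ζ)**: the label weights `ω` of record at `θ.A₁`, `θ.ζ` along `gOfRecord₁₀ θ p` are jointly measurable in `(V′, U)` — `Provisos₁₀.measω`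
verbatim. [cite: Balaban1988Convergent, (3.2)–(3.5) p.265, (3.16) p.268, (3.24)–(3.25) p.270 (bookkeeping)] -/
theorem Stage9Params.measω_of_localBg (θ : Stage9Params F N) (hU : LocalBgMeasurable F N θ.ν) (hζ : ZetaMeasurable F N θ.ζ) :
    ∀ (p : B12.RunParams) (k : ℕ), k < p.K → ∀ (s : SeqOfRecord F θ.ν θ.τ9.M (gOfRecord₁₀ F N θ p) p.K k) (t : LbOfRecord F θ.ν p (gOfRecord₁₀ F N θ p) k),
      Measurable (fun z : GaugeField (F.P p.K) (k + 1) (SU N) × GaugeField (F.P p.K) k (SU N) =>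
        ωOfRecord F N θ.ν θ.τ9.M p (gOfRecord₁₀ F N θ p) k θ.A₁ θ.ζ s t z.2 z.1) :=
  fun p k _ s t => measurable_ωOfRecord_of_localBg hU θ.τ9.M p _ k θ.A₁ hζ s t

/-- **ROW P1 `intPiece` UNDER (H-U) ∧ (H-ζ) ∧ THE ζ-SIZE LAW, identity selector, NO marginal-density bound**: the level-`k` pieces `χ_k(s)·slot_k(s)` of `ρ_k` of record
along `gOfRecord₁₀ θ p` are integrable, `k < K` — `Provisos₁₀.intPiece` verbatim for a `θ` whose selector is the identity.
[cite: Balaban1988Convergent, (2.18) p.257, (3.24)–(3.25) p.270; Balaban1989LargeFieldI, (0.3)–(0.4) p.176 (bookkeeping)] -/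
theorem Stage9Params.intPiece_of_localBg (θ : Stage9Params F N) (hsel : θ.ppSel = ppSelIdOfRecord F θ.ν θ.τ9.M) (hU : LocalBgMeasurable F N θ.ν)
    (hζ : ZetaMeasurable F N θ.ζ) (hζa : IsZetaAbsLeOne F N θ.ν θ.τ9.M θ.ζ) :
    ∀ (p : B12.RunParams) (k : ℕ), k < p.K → ∀ s : SeqOfRecord F θ.ν θ.τ9.M (gOfRecord₁₀ F N θ p) p.K k,
      Integrable (fun U => chiSeqOfRecord F N θ.ν θ.τ9.M (gOfRecord₁₀ F N θ p) p.K k s U *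
        slotsOfRecord F N θ.ν θ.τ9 (EOfRecord₁₀ F N θ) (wOfRecord₉ F N θ) θ.ppSel p (gOfRecord₁₀ F N θ p) k s U) (fieldMeasure (F.P p.K) k (SU N)) := by
  intro p k hk s
  rw [hsel]
  exact intPiece_ppSelId_of_measurable F N θ.ν θ.τ9 (EOfRecord₁₀ F N θ) (fun j _ s' => measurable_wOfRecord_of_localBg hU θ.τ9.M θ.A₁ hζ p _ j s')
    (fun j _ s' U V' => abs_wOfRecord_le_one F N θ.ν θ.τ9.M θ.A₁ hζa p _ j s' U V')
    (fun j _ s' => measurable_chiSeqOfRecord_of_localBg hU θ.τ9.M _ p.K j s') k hk s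

end Stage9


end Literature.MathematicalPhysics.QuantumFieldTheory.Balaban1983to89.Node00

end
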